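import Mathlib
import HarnessLib
import Literature.MathematicalPhysics.QuantumLattice.HubbardFreeCovariance

/-!
# Route `KLProgramme` — crux K3 split, ENGINE child: Matsubara sums are midpoint Riemann sums — the `M`-uniform discretisation
# error `|(1/β) Σ_ω g(ω) − (2π)⁻¹ ∫ g| ≤ D·(R + 2π/β)/β` behind the thermal-layer majorant `thermalBar` (cell gate-hubbard-kl, seat
# hubbard-kl-k3c2-p2 «thermal-bar induction n ≤ nScales β + 1»)

WHY.  The (T) term of the engine slot (`thermalBar G P U β n = CF·(Klam U)²·4^{-(n_β−n)}`, p1's `…SplitEngineV4`) is the cost of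
replacing, at scale `n`, the DISCRETE fermionic Matsubara sum `(1/β) Σ_{k₀ ∈ π(2ℤ+1)/β}` of the single-slice particle–hole integrand
by the `k₀`-integral `(2π)⁻¹ ∫ dk₀`, under which the `(k₀, ξ)`-rotation cancellation acts (DECOMP App. E Lemma E.2 (ii) STEP 3–4;
HOME/p1/E2-NOTE.md §3: «Matsubara sum → integral; cost `C_N γ^{N(h_β−j)}`», here `N = 1`).  The kept frequencies
`ω_i = π(2(i−M)+1)/β`, `i : MatsubaraIdx M = Fin (2M)` (the tree's `matsubaraFreq`), are exactly the MIDPOINTS of the cells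
`[2π(i−M)/β, 2π(i−M+1)/β]` of mesh `h = 2π/β` tiling `[−2πM/β, 2πM/β]`; for an integrand `g` that is `D`-Lipschitz and vanishes for
`|k₀| ≥ R`, the midpoint rule gives an error `≤ D·h·(R + h)` INDEPENDENT of the Matsubara cutoff `M` as soon as the kept cells cover the
support (`M ≥ βR/(2π) + 1`) — the order of limits of K3 (`M → ∞` first) needs exactly this uniformity.

CONTENT (pure analysis; nothing about the model is asserted):
* `klmr_midpoint_sum_sub_integral_norm_le` — the abstract midpoint rule on the uniform grid `((i − K) + ½)·h`, `i < 2K`, for a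
  `D`-Lipschitz `g : ℝ → E` vanishing outside `(−R, R)`, `R + h ≤ K·h`: `‖Σ_i h • g(cᵢ) − ∫ g‖ ≤ D·h·(R + h)`;
* `klmr_matsubara_sum_sub_integral_norm_le` — the Matsubara form: `‖β⁻¹ • Σ_{i : MatsubaraIdx M} g(ω_i) − (2π)⁻¹ • ∫ g‖ ≤ D·(R + 2π/β)/β`
  for `βR/(2π) + 1 ≤ M`;
* `klmr_matsubara_sum_eq_of_support` — for such `M` the truncated Matsubara sum does not depend on `M` (cells beyond the support carry
  zeros): the sum at `M` equals the sum at any `M' ≥ M` — the form child 4/5's `M → ∞` bookkeeping reads.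
The scale form «error ≤ const·(π/β)/Λ_n ≤ const·4^{-(n_β−n)}» is the dictionary of `…SplitThermalLayer` (`klth_ratio_le_inv_pow`).
References: BGM 2006 = Benfatto–Giuliani–Mastropietro, Ann. Henri Poincaré 7 (2006) 809, §2.1 (Matsubara grid), (2.38); HOME/p1/E2-NOTE.md
§3 STEP 3; standard numerical analysis (midpoint rule for Lipschitz integrands) [folklore].
-/

noncomputable section

namespace Summit.HubbardSuperconductivity.HubbardSuperconductivity.Theorems.KLRegimeSplit

set_option linter.dupNamespace false -- summit = problem name (single-conjunct summit), D-0017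

open Real Finset MeasureTheory intervalIntegral Literature.MathematicalPhysics.QuantumLattice

variable {E : Type*} [NormedAddCommGroup E] [NormedSpace ℝ E] [CompleteSpace E]

/-! ## §1 The abstract midpoint rule on a uniform grid, support-localised -/

/-- **One cell of the midpoint rule**: for a `D`-Lipschitz `g`, `‖h • g(a + h/2) − ∫_a^{a+h} g‖ ≤ D·h²/2` (`h ≥ 0`). -/
theorem klmr_cell_norm_le {g : ℝ → E} {D : ℝ} (hlip : ∀ t t', ‖g t - g t'‖ ≤ D * |t - t'|) {h : ℝ} (hh : 0 ≤ h) (a : ℝ) :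
    ‖h • g (a + h / 2) - ∫ t in a..(a + h), g t‖ ≤ D * h ^ 2 / 2 := by
  have hD : 0 ≤ D := by
    have := hlip 0 1
    have h0 : (0 : ℝ) ≤ ‖g 0 - g 1‖ := norm_nonneg _
    norm_num at this
    linarith
  have hcont : Continuous g := by
    have hl : LipschitzWith (Real.toNNReal D) g := LipschitzWith.of_dist_le_mul fun t t' => by
      rw [dist_eq_norm, Real.dist_eq, Real.coe_toNNReal D hD]
      exact hlip t t'
    exact hl.continuous
  have h1 : h • g (a + h / 2) = ∫ _ in a..(a + h), g (a + h / 2) := by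
    rw [intervalIntegral.integral_const]; simp
  rw [h1, ← intervalIntegral.integral_sub intervalIntegrable_const (hcont.intervalIntegrable _ _)]
  have h2 := intervalIntegral.norm_integral_le_of_norm_le_const (a := a) (b := a + h) (C := D * (h / 2))
    (f := fun t => g (a + h / 2) - g t) fun t ht => ?_
  · calc ‖∫ t in a..(a + h), g (a + h / 2) - g t‖ ≤ D * (h / 2) * |a + h - a| := h2
      _ = D * h ^ 2 / 2 := by rw [add_sub_cancel_left, abs_of_nonneg hh]; ring
  · rw [Set.uIoc_of_le (by linarith)] at ht
    refine (hlip _ _).trans (mul_le_mul_of_nonneg_left ?_ hD)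
    rw [abs_le]; constructor <;> linarith [ht.1, ht.2]

omit [CompleteSpace E] in
/-- **A cell off the support contributes nothing**: if `g` vanishes for `|t| ≥ R` and the cell `[a, a+h]` does not meet `(−R, R)`, then
`h • g(a + h/2) − ∫_a^{a+h} g = 0` (`h ≥ 0`). -/
theorem klmr_cell_eq_zero {g : ℝ → E} {R : ℝ} (hsupp : ∀ t, R ≤ |t| → g t = 0) {h : ℝ} (hh : 0 ≤ h) {a : ℝ}
    (hoff : R ≤ a ∨ a + h ≤ -R) :
    h • g (a + h / 2) - ∫ t in a..(a + h), g t = 0 := by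
  have hzero : ∀ t ∈ Set.Icc a (a + h), g t = 0 := by
    intro t ht
    apply hsupp
    rcases hoff with h1 | h1
    · exact le_trans (by linarith [ht.1]) (le_abs_self t)
    · exact le_trans (by linarith [ht.2]) (neg_le_abs t)
  have hmid : g (a + h / 2) = 0 := hzero _ ⟨by linarith, by linarith⟩
  have hint : ∫ t in a..(a + h), g t = 0 := by
    rw [intervalIntegral.integral_congr (g := fun _ => (0 : E)) fun t ht => ?_]
    · simp
    · rw [Set.uIcc_of_le (by linarith)] at ht
      exact hzero t ht
  rw [hmid, hint, smul_zero, sub_zero]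

/-- **The midpoint rule on a uniform grid, support-localised** (the `K`-uniform form): for `g : ℝ → E` `D`-Lipschitz and vanishing for
`|t| ≥ R` (`R ≥ 0`), mesh `h > 0` and any `K` with `R + h ≤ K·h`, the midpoint sum over the `2K` cells `[(i−K)h, (i−K+1)h]` satisfies
`‖Σ_{i<2K} h • g(((i−K)+½)h) − ∫ g‖ ≤ D·h·(R + h)` — only the `≤ 2R/h + 2` cells meeting the support contribute, each `≤ D h²/2`. -/
theorem klmr_midpoint_sum_sub_integral_norm_le {g : ℝ → E} {D : ℝ} (hD : 0 ≤ D)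
    (hlip : ∀ t t', ‖g t - g t'‖ ≤ D * |t - t'|) {R : ℝ} (hR : 0 ≤ R) (hsupp : ∀ t, R ≤ |t| → g t = 0)
    {h : ℝ} (hh : 0 < h) {K : ℕ} (hK : R + h ≤ K * h) :
    ‖(∑ i ∈ range (2 * K), h • g ((((i : ℝ) - K) + 1 / 2) * h)) - ∫ t, g t‖ ≤ D * h * (R + h) := by
  have hcont : Continuous g := by
    have hl : LipschitzWith (Real.toNNReal D) g := LipschitzWith.of_dist_le_mul fun t t' => by
      rw [dist_eq_norm, Real.dist_eq, Real.coe_toNNReal D hD]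
      exact hlip t t'
    exact hl.continuous
  -- the grid
  set a : ℕ → ℝ := fun i => ((i : ℝ) - K) * h with ha
  have ha_succ : ∀ i : ℕ, a (i + 1) = a i + h := fun i => by simp only [ha]; push_cast; ring
  have hmid : ∀ i : ℕ, (((i : ℝ) - K) + 1 / 2) * h = a i + h / 2 := fun i => by simp only [ha]; ring
  have ha0 : a 0 = -(K * h) := by simp [ha]
  have ha2K : a (2 * K) = K * h := by simp only [ha]; push_cast; ring
  -- the integral lives on `[-Kh, Kh]`
  have hRK : R ≤ K * h := by linarith
  have hsupport : Function.support g ⊆ Set.Ioc (a 0) (a (2 * K)) := by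
    intro t ht
    rw [Function.mem_support] at ht
    have hlt : |t| < R := lt_of_not_ge fun hge => ht (hsupp t hge)
    rw [abs_lt] at hlt
    rw [ha0, ha2K]
    exact ⟨by linarith [hlt.1], by linarith [hlt.2]⟩
  have hint_eq : ∫ t, g t = ∫ t in (a 0)..(a (2 * K)), g t :=
    (intervalIntegral.integral_eq_integral_of_support_subset hsupport).symm
  have hsplit : ∫ t in (a 0)..(a (2 * K)), g t = ∑ i ∈ range (2 * K), ∫ t in (a i)..(a (i + 1)), g t :=
    (intervalIntegral.sum_integral_adjacent_intervals fun i _ => hcont.intervalIntegrable _ _).symm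
  rw [hint_eq, hsplit, ← Finset.sum_sub_distrib]
  -- the cells meeting the support
  set S : Finset ℕ := (range (2 * K)).filter fun i => a i < R ∧ -R < a i + h with hS
  have hterm : ∀ i ∈ range (2 * K),
      ‖h • g ((((i : ℝ) - K) + 1 / 2) * h) - ∫ t in (a i)..(a (i + 1)), g t‖ ≤
        if i ∈ S then D * h ^ 2 / 2 else 0 := by
    intro i hi
    rw [hmid, ha_succ]
    split_ifs with hiS
    · exact klmr_cell_norm_le hlip hh.le (a i)
    · have hoff : R ≤ a i ∨ a i + h ≤ -R := by
        simp only [hS, mem_filter, not_and, not_lt] at hiS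
        by_cases h1 : a i < R
        · exact Or.inr (hiS hi h1)
        · exact Or.inl (not_lt.mp h1)
      rw [klmr_cell_eq_zero hsupp hh.le hoff, norm_zero]
  -- count of the contributing cells: `card S ≤ 2R/h + 2`
  have hcard : (S.card : ℝ) ≤ 2 * R / h + 2 := by
    rcases S.eq_empty_or_nonempty with h0 | hne
    · rw [h0, card_empty, Nat.cast_zero]; positivity
    · set m := S.min' hne with hm
      set m' := S.max' hne with hm'
      have hmS : m ∈ S := min'_mem S hne
      have hm'S : m' ∈ S := max'_mem S hne
      have hsub : S ⊆ Icc m m' := fun i hi => mem_Icc.mpr ⟨min'_le S i hi, le_max' S i hi⟩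
      have hmm' : m ≤ m' := min'_le S m' hm'S
      have h1 : S.card ≤ m' + 1 - m := (card_le_card hsub).trans (by rw [Nat.card_Icc])
      have h2 : ((m' + 1 - m : ℕ) : ℝ) = (m' : ℝ) + 1 - m := by
        rw [Nat.cast_sub (by omega)]; push_cast; ring
      have h3 : (S.card : ℝ) ≤ (m' : ℝ) + 1 - m := by rw [← h2]; exact_mod_cast h1
      -- `a m' < R` and `-R < a m + h` give `(m' - m) h < 2R + h`
      have hm'R : a m' < R := ((mem_filter.mp hm'S).2).1
      have hmR : -R < a m + h := ((mem_filter.mp hmS).2).2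
      simp only [ha] at hm'R hmR
      have h4 : ((m' : ℝ) - m) * h < 2 * R + h := by nlinarith
      have h5 : (m' : ℝ) - m < 2 * R / h + 1 := by
        rw [div_add_one hh.ne', lt_div_iff₀ hh]; linarith
      linarith
  calc ‖∑ i ∈ range (2 * K), (h • g ((((i : ℝ) - K) + 1 / 2) * h) - ∫ t in (a i)..(a (i + 1)), g t)‖
      ≤ ∑ i ∈ range (2 * K), ‖h • g ((((i : ℝ) - K) + 1 / 2) * h) - ∫ t in (a i)..(a (i + 1)), g t‖ := norm_sum_le _ _
    _ ≤ ∑ i ∈ range (2 * K), (if i ∈ S then D * h ^ 2 / 2 else 0) := sum_le_sum hterm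
    _ = S.card * (D * h ^ 2 / 2) := by
        have hSsub : S ⊆ range (2 * K) := by rw [hS]; exact filter_subset _ _
        rw [← Finset.sum_filter, Finset.filter_mem_eq_inter, Finset.inter_eq_right.mpr hSsub, Finset.sum_const,
          nsmul_eq_mul]
    _ ≤ (2 * R / h + 2) * (D * h ^ 2 / 2) := mul_le_mul_of_nonneg_right hcard (by positivity)
    _ = D * h * (R + h) := by field_simp

/-! ## §2 The Matsubara form -/

/-- The kept fermionic frequencies are the midpoints of the grid of mesh `2π/β`: `ω_i = ((i − M) + ½)·(2π/β)`. -/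
theorem klmr_matsubaraFreq_eq_midpoint (β : ℝ) (M : ℕ) (i : MatsubaraIdx M) :
    matsubaraFreq β M i = ((((i : ℕ) : ℝ) - M) + 1 / 2) * (2 * Real.pi / β) := by
  simp only [matsubaraFreq, matsubaraInt]
  push_cast
  ring

/-- **Matsubara sums are midpoint Riemann sums, `M`-uniformly**: for `g : ℝ → E` `D`-Lipschitz and vanishing for `|k₀| ≥ R` (`R ≥ 0`),
`β > 0` and every Matsubara cutoff `M ≥ βR/(2π) + 1`,
`‖β⁻¹ • Σ_{i : MatsubaraIdx M} g(ω_i) − (2π)⁻¹ • ∫ g‖ ≤ D·(R + 2π/β)/β`. -/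
theorem klmr_matsubara_sum_sub_integral_norm_le {g : ℝ → E} {D : ℝ} (hD : 0 ≤ D)
    (hlip : ∀ t t', ‖g t - g t'‖ ≤ D * |t - t'|) {R : ℝ} (hR : 0 ≤ R) (hsupp : ∀ t, R ≤ |t| → g t = 0)
    {β : ℝ} (hβ : 0 < β) {M : ℕ} (hM : β * R / (2 * Real.pi) + 1 ≤ M) :
    ‖β⁻¹ • (∑ i : MatsubaraIdx M, g (matsubaraFreq β M i)) - (2 * Real.pi)⁻¹ • ∫ t, g t‖ ≤
      D * (R + 2 * Real.pi / β) / β := by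
  set h : ℝ := 2 * Real.pi / β with hh_def
  have hh : 0 < h := by positivity
  have hK : R + h ≤ (M : ℝ) * h := by
    have h1 : β * R / (2 * Real.pi) * h = R := by rw [hh_def]; field_simp
    have h2 : (β * R / (2 * Real.pi) + 1) * h ≤ (M : ℝ) * h := mul_le_mul_of_nonneg_right hM hh.le
    nlinarith
  have hmain := klmr_midpoint_sum_sub_integral_norm_le hD hlip hR hsupp hh hK
  -- the Matsubara sum is the grid sum
  have hsum : ∑ i : MatsubaraIdx M, g (matsubaraFreq β M i) =
      ∑ i ∈ range (2 * M), g ((((i : ℝ) - M) + 1 / 2) * h) := by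
    rw [← Fin.sum_univ_eq_sum_range (f := fun i : ℕ => g ((((i : ℝ) - M) + 1 / 2) * h))]
    refine Finset.sum_congr rfl fun i _ => ?_
    rw [klmr_matsubaraFreq_eq_midpoint]
  -- `β⁻¹ • Σ = (2π)⁻¹ • (h • Σ)`
  have hscal : β⁻¹ • (∑ i : MatsubaraIdx M, g (matsubaraFreq β M i)) =
      (2 * Real.pi)⁻¹ • ∑ i ∈ range (2 * M), h • g ((((i : ℝ) - M) + 1 / 2) * h) := by
    rw [hsum, ← Finset.smul_sum, smul_smul]
    congr 1
    rw [hh_def]; field_simp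
  rw [hscal, ← smul_sub, norm_smul, Real.norm_of_nonneg (by positivity)]
  calc (2 * Real.pi)⁻¹ * ‖∑ i ∈ range (2 * M), h • g ((((i : ℝ) - M) + 1 / 2) * h) - ∫ t, g t‖
      ≤ (2 * Real.pi)⁻¹ * (D * h * (R + h)) := mul_le_mul_of_nonneg_left hmain (by positivity)
    _ = D * (R + 2 * Real.pi / β) / β := by rw [hh_def]; field_simp

omit [NormedSpace ℝ E] [CompleteSpace E] in
/-- **Beyond the support the truncated Matsubara sum is `M`-independent**: if `g` vanishes for `|k₀| ≥ R` and `M ≥ βR/(2π) + 1`, the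
kept-frequency sum at `M` equals the one at every larger cutoff `M'` (the added frequencies satisfy `|ω| ≥ R`). -/
theorem klmr_matsubara_sum_eq_of_support {g : ℝ → E} {R : ℝ} (hsupp : ∀ t, R ≤ |t| → g t = 0)
    {β : ℝ} (hβ : 0 < β) {M M' : ℕ} (hM : β * R / (2 * Real.pi) + 1 ≤ M) (hMM' : M ≤ M') :
    ∑ i : MatsubaraIdx M', g (matsubaraFreq β M' i) = ∑ i : MatsubaraIdx M, g (matsubaraFreq β M i) := by
  -- both sums are sums over the integer label `n = i - M` of `g(π(2n+1)/β)`; reindex by the label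
  set f : ℤ → E := fun n => g (Real.pi * (2 * (n : ℝ) + 1) / β) with hf
  have hrew : ∀ (N : ℕ), ∑ i : MatsubaraIdx N, g (matsubaraFreq β N i) = ∑ n ∈ Finset.Ico (-(N : ℤ)) N, f n := by
    intro N
    have : ∑ i : MatsubaraIdx N, g (matsubaraFreq β N i) = ∑ i : Fin (2 * N), f ((i : ℤ) - N) := by
      refine Finset.sum_congr rfl fun i _ => ?_
      simp only [hf, matsubaraFreq, matsubaraInt]
    rw [this]
    -- `i ↦ i - N` is a bijection `Fin (2N) → Ico (-N) N`
    refine Finset.sum_nbij (fun i : Fin (2 * N) => (i : ℤ) - N) (fun i _ => ?_) (fun i _ j _ hij => ?_) (fun n hn => ?_)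
      (fun _ _ => rfl)
    · have := i.isLt
      rw [Finset.mem_Ico]; omega
    · exact Fin.ext (by simpa using hij)
    · rw [Finset.coe_Ico, Set.mem_Ico] at hn
      refine ⟨⟨(n + N).toNat, by omega⟩, by simp, ?_⟩
      simp only; omega
  rw [hrew, hrew]
  -- the extra labels carry zeros
  symm
  refine Finset.sum_subset (fun n hn => ?_) (fun n hn hnot => ?_)
  · simp only [mem_Ico] at hn ⊢; omega
  · simp only [mem_Ico, not_and, not_lt] at hn hnot
    simp only [hf]
    apply hsupp
    -- `|n + 1/2| ≥ M - 1/2 ≥ βR/(2π) + 1/2`, so `|π(2n+1)/β| ≥ R`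
    have hMR : β * R / (2 * Real.pi) + 1 ≤ (M : ℝ) := hM
    have hπ := Real.pi_pos
    rw [abs_div, abs_of_pos hβ, le_div_iff₀ hβ, abs_mul, abs_of_pos hπ]
    have hkey : β * R ≤ Real.pi * |2 * (n : ℝ) + 1| := by
      have h1 : β * R ≤ 2 * Real.pi * ((M : ℝ) - 1) := by
        have := mul_le_mul_of_nonneg_left hMR (by positivity : (0 : ℝ) ≤ 2 * Real.pi)
        have h' : 2 * Real.pi * (β * R / (2 * Real.pi) + 1) = β * R + 2 * Real.pi := by field_simp
        linarith
      have h2 : 2 * ((M : ℝ) - 1) ≤ |2 * (n : ℝ) + 1| := by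
        rcases lt_or_ge n (-(M : ℤ)) with hlt | hge
        · have : (n : ℝ) ≤ -(M : ℝ) - 1 := by exact_mod_cast (show n ≤ -(M : ℤ) - 1 by omega)
          rw [abs_of_neg (by linarith)]; linarith
        · have hge' : (M : ℤ) ≤ n := hnot hge
          have : (M : ℝ) ≤ n := by exact_mod_cast hge'
          rw [abs_of_nonneg (by linarith)]; linarith
      nlinarith
    linarith

end Summit.HubbardSuperconductivity.HubbardSuperconductivity.Theorems.KLRegimeSplit

end
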